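import Summits.BirchSwinnertonDyer.BirchSwinnertonDyer.Theorems.PrintCf2RubinValueTwoKatzMeasureJZeroSeamClassSumAtLevelHsum
import Literature.NumberTheory.NumberFields.RayClassFieldAdicCharacterTwistGrossencharacter
import Literature.NumberTheory.EllipticCurves.ProfiniteGroupDistributionTranslateScale
import HarnessLib

/-!
# The SEAM of the `j = 0` lane — THE BRIDGE `P1` ⇐ [I1] + [I2] + (U♯): quantifier packaging of the per-level class-sum hypothesis
# of `KatzMeasureJZeroTop.katzSeamSupply_two_of_perLevel` (de Shalit II.4.14 (38)→(40) at `j = 0`, II.4.12 (31))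

Cell `bsd-print-cf2`, width seat `bsd-line-cf2-p1-w3` g32; `--supports` the crux stmt-BirchSwinnertonDyer-20368 (helper, Theses-free).
THEOREMS ONLY; no `def`, no named fact, no `sorry`; CONDITIONAL on the prints II.2.4 (ii)/(iii), II.2.5 (i) (`DeShalit1987.prop24_ii_galoisAction`,
`prop24_iii_unit`, `prop25_i_normRelation`) and on ONE lane input taken HERE AS A HYPOTHESIS in its published shape (the other one is in the tree):

* `hI2` — the per-unit VALUES of the seam ([I2] v2, width seat -w8: `KatzMeasureJZeroSeam.perUnitValues_of_lane`): at a fixed complex scale `Ω`,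
  a fixed `τ ∈ Γ_K` (the discrepancy of the two readings `θ` / `ι⁻¹ ∘ σ_{w₀}`, `…KatzMeasureJZeroTop.exists_absGal_reading_conj_of_split`), ONE
  value constant `A₀ ∈ ℤ₂ˣ`, and the curve's Grössencharacter `ψ_K` on ideals prime to `𝔣_ψ` (de Shalit II.1.5 (15)), for every tame set, chain
  and two-variable measure, eventually in the level `M`: an integral ideal `𝔟` prime to `𝔣_ψ·𝔪_M·v` with `τ⁻¹|_{K(𝔣_ψ𝔪_M v)} = (𝔟, K(𝔣_ψ𝔪_M v)/K)`,
  the lattices `Ω·σ(𝔪_M)`, `Ω·σ(𝔪_M 𝔟'⁻¹)`, and the value identities `hvals` of [I1] at the evaluation point `σ(ψ_K(𝔟))·Ω`;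
* (U♯) — the `τ`-UNIT (width seat -w5, `Literature.NumberTheory.NumberFields.exists_unit_forall_rayAdicCharacter_mul_integerUnit_grossen_eq`, in the
  tree): ONE `U ∈ 𝒪_vˣ` with `κ_𝔪(τ·g)·ψ_K(𝔟)_v = U` at every lane modulus `𝔪 ⊆ v̄²`, every such `𝔟` and every Artin lift `g` of `𝔟` on the `v`-tower.

`P1_of_perUnitValues` then proves -w3 g31's per-level hypothesis `P1` of `katzSeamSupply_two_of_perLevel` (p769392) VERBATIM:
`Ω := Ω`, `Θε := Θ(coeff₁ ϑ)` (`‖·‖ ≤ 1` by `hθ1`), `τ := τ`, and **`Ωp := Θ(coeff₁ ϑ)·θ(e₂⁻¹(A₀)·U⁻¹) ∈ (𝒪̂_nr)ˣ`**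
(`exists_units_unrIntegers_coe_eq_thetaC_coeff_one_compSeriesC_mul_of_isUniformizer`); per instance [I1]
(`KatzMeasureJZeroSeam.hsumBody_at_level_of_perUnitValues`, p770175) with `β₁ := ψ_K(𝔟)`, `A₁ := cast A₀`, `D := ê(τ)`:
its `hI` is `∫ ê d(δ_τ μ) = ê(τ)·∫ ê dμ` (`integral_twisting_zero_of_map_mul'`), and its `hΩp`, i.e.
`Ωp^m = ê(τ)·(Θε·A₁)^m·ι⁻¹(σ(β₁)^{−m}·χ̃λ̃^m((β₁)))`, is read through `ê(g_{(β₁)}) = ι⁻¹(χ̃λ̃^m((β₁)))` (A9,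
`IsPAdicAvatarOutside.avatarValueAt_eq_idealPow_mul_pow_of_forall_absRestrictNormalHom_eq_artinSymbol`), `ê(τ)·ê(g) = ê(τg)`,
`ê(τg) = cast(e₂ κ_𝔪(τg)⁻¹)^m` (`KatzMeasureJZeroSeam.avatarValueAt_ker_eq_padicIntCast_inv_pow`), `κ_𝔪(τg)⁻¹ = β₁,v·U⁻¹` ((U♯)) and the
compatibility of the two readings on `K` itself, `cast(e₂ β₁,v) = ι⁻¹(σ_{w₀}(β₁))` (`AvatarOnRay.comp_eq_of_place_eq` + the rigidity of `ℤ₂`).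
Nothing here closes a crux; no summit statement is proved; BSD is not proved by any of this.

References: [deShalit1987] II.4.12 (31) (p. 66–69), II.4.14 (36)–(40) (p. 71–73), II.1.5 (15) (p. 36–37); [NeukirchANT1999] Ch. VI §7 (7.1).
-/


-- the summit namespace `Summit.BirchSwinnertonDyer.BirchSwinnertonDyer` repeats the problem name by design (D-0017)
set_option linter.dupNamespace false
set_option autoImplicit false

noncomputable section

open scoped Classical nonZeroDivisors NumberField
open NumberField Field IsDedekindDomain IsDedekindDomain.HeightOneSpectrum ValuativeRel IsLocalRing Literature.NumberTheory.NumberFields Literature.NumberTheory.PAdicHodge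
open Literature.NumberTheory.GaloisRepresentations Literature.NumberTheory.GaloisRepresentations.IsNonarchimedeanLocalField Literature.NumberTheory.GaloisRepresentations.LubinTate
  Literature.NumberTheory.GaloisRepresentations.ArtinLocalGlobal Literature.NumberTheory.GaloisRepresentations.HeckeCharacter
open Literature.NumberTheory.EllipticCurves Literature.NumberTheory.EllipticCurves.GroupDistribution Literature.NumberTheory.EllipticCurves.DeShalit1987
open Literature.NumberTheory.ComplexMultiplication.EllipticUnits Literature.NumberTheory.LFunctions
open Literature.NumberTheory.LFunctions.AbelianDensity (artinSymbol)
open Summit.BirchSwinnertonDyer.BirchSwinnertonDyer.Theorems.PrintCf2.EllipticUnitsLocal Summit.BirchSwinnertonDyer.BirchSwinnertonDyer.Theorems.PrintCf2.EllipticUnitsGlobal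
  Summit.BirchSwinnertonDyer.BirchSwinnertonDyer.Theorems.PrintCf2.EllipticUnitsGlobalCompat Summit.BirchSwinnertonDyer.BirchSwinnertonDyer.Theorems.PrintCf2.EllipticUnitsTwoVariable

namespace Summit.BirchSwinnertonDyer.BirchSwinnertonDyer.Theorems.PrintCf2.KatzMeasureJZeroTop

attribute [local instance] GlobalNormCoherentUnits.instCommMonoid GlobalNormCoherentUnits.galAction RelNormCoherentUnits.instCommMonoid
attribute [local instance] ltNormUniformSpace ltNormIsUniformAddGroup rk1 nF nE fintypeResidueField

set_option maxHeartbeats 3200000 in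
/-- ★★★ **The BRIDGE of the `j = 0` seam**: -w3 g31's per-level hypothesis `P1` of `katzSeamSupply_two_of_perLevel` from the per-unit
VALUES ([I2] v2, hypothesis `hI2`) and the `τ`-UNIT (U♯) `exists_unit_forall_rayAdicCharacter_mul_integerUnit_grossen_eq`, over [I1] `KatzMeasureJZeroSeam.hsumBody_at_level_of_perUnitValues`
with `β₁ := ψ_K(𝔟)`, `A₁ := cast A₀`, `D := ê(τ)`, `Θε := Θ(coeff₁ ϑ)`, `Ωp := Θ(coeff₁ ϑ)·θ(e₂⁻¹(A₀)·U⁻¹)`.  GIVEN II.2.4 (ii)/(iii), II.2.5 (i).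
[cite: deShalit1987, II.4.12 (31) (p. 66–69), II.4.14 (36)–(40) (p. 71–73)] -/
theorem P1_of_perUnitValues
    (h24ii : DeShalit1987.prop24_ii_galoisAction) (h24iii : DeShalit1987.prop24_iii_unit) (h25 : DeShalit1987.prop25_i_normRelation)
    (hI2 : ∀ (K : Type) [Field K] [NumberField K] [IsTotallyComplex K] (hK : IsImaginaryQuadratic K) (_ : NumberField.classNumber K = 1)
      (ι : PadicAlgCl 2 ≃+* ℂ) (w₀ : InfinitePlace K) (v vbar : HeightOneSpectrum (𝓞 K))
        (hv2 : ((2 : ℕ) : 𝓞 K) ∈ v.asIdeal) (hvbar2 : ((2 : ℕ) : 𝓞 K) ∈ vbar.asIdeal) (hne : vbar ≠ v)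
        (_ : ∀ (w : InfinitePlace K) (k : 𝓞 K), k ∈ v.asIdeal ↔ ‖ι.symm (w.embedding (k : K))‖ < 1) {α₀ : 𝓞 K} (hv0 : v.asIdeal = Ideal.span {α₀})
        (hdK : NumberField.discr K = -7) (hα₀ : α₀ ^ 2 - α₀ + 2 = 0) (hw2 : ∀ uu : (𝓞 K)ˣ, (uu : 𝓞 K) - 1 ∈ vbar.asIdeal ^ 2 → uu = 1)
    (hq : residueFieldCard (v.adicCompletion K) = 2) (h2 : (valuation (v.adicCompletion K)).IsUniformizer ((((2 : ℕ) : 𝒪[v.adicCompletion K]) : v.adicCompletion K)))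
    (u : 𝒪[v.adicCompletion K]ˣ)
    (hu : ((((u : 𝒪[v.adicCompletion K]) * ((2 : ℕ) : 𝒪[v.adicCompletion K]) : 𝒪[v.adicCompletion K]) : v.adicCompletion K)) = ((α₀ : K) : v.adicCompletion K))
    {σ₀ : absoluteGaloisGroup (v.adicCompletion K)} (hσ₀ : IsAbsArithFrob σ₀) {ε : (maxUnramifiedCompletion (v.adicCompletion K))ˣ}
    (hε : maxUnramifiedCompletion.galAut (v.adicCompletion K) σ₀ (ε : maxUnramifiedCompletion (v.adicCompletion K)) =
      algebraMap 𝒪[v.adicCompletion K] (maxUnramifiedCompletion (v.adicCompletion K)) (u : 𝒪[v.adicCompletion K]) * (ε : maxUnramifiedCompletion (v.adicCompletion K)))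
    (θ : CompletedAlgClosure (v.adicCompletion K) →+* ℂ_[2]) (hθ1 : ∀ z : CBall (v.adicCompletion K), ‖θ (z : CompletedAlgClosure (v.adicCompletion K))‖ ≤ 1)
    (e₂ : v.adicCompletionIntegers K ≃+* ℤ_[2]) (hΘe : ∀ a : 𝒪[v.adicCompletion K], (θ.comp ((CBall (v.adicCompletion K)).subtype.comp
        (algebraMap (UnrCoeff (v.adicCompletion K)) (CBall (v.adicCompletion K))))) (intToUnrCoeff (v.adicCompletion K) a) =
      padicIntCast ℂ_[2] (((e₂ : v.adicCompletionIntegers K →+* ℤ_[2]).comp (integerEquivAdicCompletionIntegers v).toRingHom) a)) (_ : Continuous θ)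
        (_ : ∀ ζ' : ℂ_[2], (∃ n : ℕ, ζ' ^ 2 ^ n = 1) → ∃ ζ : CompletedAlgClosure (v.adicCompletion K), (∃ n : ℕ, ζ ^ 2 ^ n = 1) ∧ θ ζ = ζ')
        (_ : Function.Bijective θ) (_ : ∀ z : CompletedAlgClosure (v.adicCompletion K), ‖z‖ < 1 → ‖θ z‖ < 1),
      ∃ (Ω : ℂ) (τ : absoluteGaloisGroup K) (A₀ : ℤ_[2]ˣ) (𝔣ψ : Ideal (𝓞 K)) (ψK : Ideal (𝓞 K) → 𝓞 K), Ω ≠ 0 ∧ 𝔣ψ ≠ ⊥ ∧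
        (∀ 𝔞 𝔟 : Ideal (𝓞 K), IsCoprime 𝔞 𝔣ψ → IsCoprime 𝔟 𝔣ψ → ψK (𝔞 * 𝔟) = ψK 𝔞 * ψK 𝔟) ∧
        (∀ 𝔞 : Ideal (𝓞 K), IsCoprime 𝔞 𝔣ψ → Ideal.span {ψK 𝔞} = 𝔞) ∧ (∀ α : 𝓞 K, α - 1 ∈ 𝔣ψ → ψK (Ideal.span {α}) = α) ∧ ψK v.asIdeal = α₀ ∧
      ∀ (S : Finset (HeightOneSpectrum (𝓞 K))), v ∉ S → vbar ∉ S → ∀ (𝔣 : ℕ → Ideal (𝓞 K)) (𝔩 : ℕ → HeightOneSpectrum (𝓞 K)) (𝔪c : ℕ → Ideal (𝓞 K)) (b : ℕ → ℕ)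
        (_ : 𝔣 0 = (∏ w ∈ S, w.asIdeal) * vbar.asIdeal ^ 2) (h𝔣succ : ∀ k, 𝔣 (k + 1) = 𝔣 k * (𝔩 k).asIdeal) (hdiv : ∀ k, (𝔩 k).asIdeal ∣ 𝔣 k)
        (_ : ∀ k, 𝔣 k = 𝔪c k * vbar.asIdeal ^ (b k + 1)) (_ : ∀ k, 1 ≤ b k) (_ : ∀ k, ¬ 𝔪c k ≤ v.asIdeal) (_ : ∀ k, ¬ 𝔪c k ≤ vbar.asIdeal) (_ : ∀ k, 𝔩 k = vbar ∨ 𝔩 k ∈ S)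
        (_ : ∀ m : ℕ, ∃ n, 𝔣 n ≤ ((∏ w ∈ S, w.asIdeal) * vbar.asIdeal) ^ m) (h𝔣0 : ∀ m : ℕ, 𝔣 m ≠ ⊥) (h𝔣1 : ∀ m : ℕ, 𝔣 m ≠ ⊤) (hvm : ∀ m : ℕ, ¬ 𝔣 m ≤ v.asIdeal)
      (hwm : ∀ (m : ℕ) (u : (𝓞 K)ˣ), (u : 𝓞 K) - 1 ∈ 𝔣 m → u = 1) (hle : ∀ m : ℕ, 𝔣 (m + 1) ≤ 𝔣 m) (α : ℕ → 𝓞 K) (hα0 : ∀ m, α m ≠ 0) (hα𝔣 : ∀ m, α m - 1 ∈ 𝔣 m)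
      (hαw : ∀ (m : ℕ) (w : HeightOneSpectrum (𝓞 K)), w ≠ v → α m ∉ w.asIdeal) (f : ℕ → ℕ) (hαπ : ∀ m, ((α m : K) : v.adicCompletion K) =
        ((((u : 𝒪[v.adicCompletion K]) * ((2 : ℕ) : 𝒪[v.adicCompletion K]) : 𝒪[v.adicCompletion K]) : v.adicCompletion K)) ^ f m)
      (E : ℕ → IntermediateField (v.adicCompletion K) (AlgebraicClosure (v.adicCompletion K)))
      (_ : ∀ m, FiniteDimensional (v.adicCompletion K) (E m)) (_ : ∀ m, IsGalois (v.adicCompletion K) (E m)) (hE : ∀ m, E m ≤ maxUnramified (v.adicCompletion K))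
      (hdegE : ∀ (m : ℕ) (w : WeilGroup (v.adicCompletion K)), WeilGroup.toAbsGalois (v.adicCompletion K) w ∈ (E m).fixingSubgroup → (f m : ℤ) ∣ WeilGroup.deg w)
      (hEE : ∀ m, E m ≤ E (m + 1)) (j : ∀ m : ℕ, unitBall (E m) →+* UnrCoeff (v.adicCompletion K))
      (_ : ∀ m, (j m).comp (algebraMap (LTCoeff (v.adicCompletion K)) (unitBall (E m))) =
        (intToUnrCoeff (v.adicCompletion K)).comp (LTCoeff.of (v.adicCompletion K)).symm.toRingHom)
      (hjC : ∀ m, (algebraMap (UnrCoeff (v.adicCompletion K)) (CBall (v.adicCompletion K))).comp (j m) = unitBallToCBall (E m))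
      (_ : ∀ (m : ℕ) (y : unitBall (E m)), j (m + 1) (inclUnitBall (F := v.adicCompletion K) (hEE m) y) = j m y)
      (ψ : ∀ m n : ℕ, ↥(absRestrictNormalHom (rayClassField K (𝔣 m))).ker ⧸ (rayAdicTower (𝔪 := 𝔣 m) (h𝔣0 m) v).U n → ZMod (2 ^ (n + 1)))
      (hψ : ∀ (m n : ℕ) (g : ↥(absRestrictNormalHom (rayClassField K (𝔣 m))).ker), g ∈ (rayAdicTower (𝔪 := 𝔣 m) (h𝔣0 m) v).U 0 →
        ψ m n ((rayAdicTower (𝔪 := 𝔣 m) (h𝔣0 m) v).proj n g) = PadicInt.toZModPow (n + 1) ((((Units.map (e₂ : v.adicCompletionIntegers K →+* ℤ_[2]).toMonoidHom).comp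
            (rayAdicCharacter (h𝔣0 m) (hvm m) (hwm m)))⁻¹ g : ℤ_[2]ˣ) : ℤ_[2])) (g : {c : Ideal (𝓞 K) // c ≠ ⊥ ∧ IsCoprime c (𝔣 0 * v.asIdeal)} → absoluteGaloisGroup K)
      (_ : ∀ (c : {c : Ideal (𝓞 K) // c ≠ ⊥ ∧ IsCoprime c (𝔣 0 * v.asIdeal)}) (m k : ℕ), absRestrictNormalHom (rayClassField K (𝔣 m * v.asIdeal ^ (k + 1))) (g c) =
          artinSymbol (galFrob K (rayClassField K (𝔣 m * v.asIdeal ^ (k + 1)))) c.1) (x : ∀ (_ : {c : Ideal (𝓞 K) // c ≠ ⊥ ∧ IsCoprime c (𝔣 0 * v.asIdeal)}) (m k : ℕ),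
        rayClassField K (𝔣 m * v.asIdeal ^ (k + 1))) (hx : ∀ (c : {c : Ideal (𝓞 K) // c ≠ ⊥ ∧ IsCoprime c (𝔣 0 * v.asIdeal)}) (m k : ℕ),
        IsThetaValueOne w₀.embedding (𝔣 m * v.asIdeal ^ (k + 1)) c.1 (algClosureEmb w₀.embedding ((x c m k : rayClassField K (𝔣 m * v.asIdeal ^ (k + 1))) : AlgebraicClosure K)))
      (_ : ∀ m n, ((rayAdicTower (𝔪 := 𝔣 m) (h𝔣0 m) v).U n).Normal) (_ : ∀ m n, ((absRayAdicTower (𝔪' := 𝔣 m) (h𝔣0 m) v).U n).Normal)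
      (μ : GroupDistribution (SubgroupTower.diagonal (fun m ↦ absRayAdicTower (𝔪' := 𝔣 m) (h𝔣0 m) v) (fun m n ↦ absRayAdicTower_U_anti (h𝔣0 m) (h𝔣0 (m + 1)) v (hle m) n)) ℂ_[2]),
      μ.bound = 1 → (∀ (c : {c : Ideal (𝓞 K) // c ≠ ⊥ ∧ IsCoprime c (𝔣 0 * v.asIdeal)}) (n : ℕ) (b : absoluteGaloisGroup K ⧸ (absRayAdicTower (𝔪' := 𝔣 n) (h𝔣0 n) v).U n),
        (twisting (g c) (Ideal.absNorm c.1 : ℂ_[2]) μ).μ n b = (GroupDistribution.induceFrom (Γ := absoluteGaloisGroup K)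
          (fun k ↦ rayAdicTower_U_eq_subgroupOf (𝔪 := 𝔣 n) (h𝔣0 n) v k) (fun b : GlobalNormCoherentUnits (h𝔣0 n) v ↦
            localMeasureFamily (h𝔣0 n) (hvm n) (hwm n) hq h2 u (E n) (hE n) hσ₀ hε θ hθ1 (j n) (hjC n) e₂ (ψ n) (hψ n)
              (RelNormCoherentUnits.ofGlobalUnits (h𝔣0 n) (hvm n) (hwm n) (isUniformizer_unit_mul h2 u) (hα0 n) (hα𝔣 n) (hαw n) (hαπ n) (E n) (hE n) (hdegE n) b))
          zero_le_one (fun _ ↦ le_rfl) (ellipticUnitsGlobal h24iii h25 hK w₀.embedding (h𝔣0 n) (h𝔣1 n) (hvm n) (hwm n) c.2.1 (isCoprime_chain 𝔣 𝔩 h𝔣succ hdiv c.2.2 n)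
            (x c n) (hx c n))).μ n b) → ∃ M₁ : ℕ, ∀ (k : ℕ) (M : ℕ), M₁ ≤ M → 𝔣 k = modulusIdeal (insert vbar S) (fun _ ↦ M) →
        ∃ (𝔟 : Ideal (𝓞 K)) (LM : PeriodPair) (Lat : Ideal (𝓞 K) → PeriodPair), IsCoprime 𝔟 (𝔣ψ * modulusIdeal (insert vbar S) (fun _ ↦ M) * v.asIdeal) ∧
          absRestrictNormalHom (rayClassField K (𝔣ψ * modulusIdeal (insert vbar S) (fun _ ↦ M) * v.asIdeal)) τ⁻¹ =
            artinSymbol (galFrob K (rayClassField K (𝔣ψ * modulusIdeal (insert vbar S) (fun _ ↦ M) * v.asIdeal))) 𝔟 ∧ (∀ z : ℂ, z ∈ LM.lattice ↔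
            ∃ y ∈ ((modulusIdeal (insert vbar S) (fun _ ↦ M) : Ideal (𝓞 K)) : FractionalIdeal (𝓞 K)⁰ K), z = Ω * w₀.embedding y) ∧
          (∀ 𝔟 : Ideal (𝓞 K), 𝔟 ≠ ⊥ → ∀ z : ℂ, z ∈ (Lat 𝔟).lattice ↔
            ∃ y ∈ ((modulusIdeal (insert vbar S) (fun _ ↦ M) : FractionalIdeal (𝓞 K)⁰ K) / (𝔟 : FractionalIdeal (𝓞 K)⁰ K)), z = Ω * w₀.embedding y) ∧
          ∀ (i : {c : Ideal (𝓞 K) // c ≠ ⊥ ∧ IsCoprime c (𝔣 0 * v.asIdeal)}) (k' : ℕ), (θ.comp ((CBall (v.adicCompletion K)).subtype.comp (algebraMap (UnrCoeff (v.adicCompletion K)) (CBall (v.adicCompletion K))))) (j k (PowerSeries.constantCoeff ((fun g' : PowerSeries (unitBall (E k)) =>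
          (invDiff (isLTRing_LTCoeff (isUniformizer_unit_mul h2 u)) (isLTSeries_LTCoeff ((u : 𝒪[v.adicCompletion K]) * ((2 : ℕ) : 𝒪[v.adicCompletion K])))).map (algebraMap (LTCoeff (v.adicCompletion K)) (unitBall (E k))) * PowerSeries.derivative (unitBall (E k)) g')^[k']
          (relLogDerivSeries (isUniformizer_unit_mul h2 u) (E k) hq (hE k) hσ₀ (RelNormCoherentUnits.ofGlobalUnits (h𝔣0 k) (hvm k) (hwm k) (isUniformizer_unit_mul h2 u) (hα0 k) (hα𝔣 k) (hαw k) (hαπ k) (E k) (hE k) (hdegE k)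
          (ellipticUnitsGlobal h24iii h25 hK w₀.embedding (h𝔣0 k) (h𝔣1 k) (hvm k) (hwm k) i.2.1 (isCoprime_chain 𝔣 𝔩 h𝔣succ hdiv i.2.2 k) (x i k) (hx i k))))))) = (padicIntCast ℂ_[2] ((A₀ : ℤ_[2]ˣ) : ℤ_[2])) ^ (k' + 1) * ((ι.symm (-12 * (((Ideal.absNorm i.1 : ℕ) : ℂ) * LM.eisensteinE (k' + 1) (w₀.embedding ((ψK 𝔟 : 𝓞 K) : K) * Ω) - (Lat i.1).eisensteinE (k' + 1) (w₀.embedding ((ψK 𝔟 : 𝓞 K) : K) * Ω))) :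
          PadicAlgCl 2) : ℂ_[2]) ∧ (θ.comp ((CBall (v.adicCompletion K)).subtype.comp (algebraMap (UnrCoeff (v.adicCompletion K)) (CBall (v.adicCompletion K))))) (j k ((frobUnitBall (E k) σ₀ : unitBall (E k) →+* unitBall (E k)) (PowerSeries.constantCoeff ((fun g' : PowerSeries (unitBall (E k)) =>
          (invDiff (isLTRing_LTCoeff (isUniformizer_unit_mul h2 u)) (isLTSeries_LTCoeff ((u : 𝒪[v.adicCompletion K]) * ((2 : ℕ) : 𝒪[v.adicCompletion K])))).map (algebraMap (LTCoeff (v.adicCompletion K)) (unitBall (E k))) * PowerSeries.derivative (unitBall (E k)) g')^[k']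
          (relLogDerivSeries (isUniformizer_unit_mul h2 u) (E k) hq (hE k) hσ₀ (RelNormCoherentUnits.ofGlobalUnits (h𝔣0 k) (hvm k) (hwm k) (isUniformizer_unit_mul h2 u) (hα0 k) (hα𝔣 k) (hαw k) (hαπ k) (E k) (hE k) (hdegE k)
          (ellipticUnitsGlobal h24iii h25 hK w₀.embedding (h𝔣0 k) (h𝔣1 k) (hvm k) (hwm k) i.2.1 (isCoprime_chain 𝔣 𝔩 h𝔣succ hdiv i.2.2 k) (x i k) (hx i k)))))))) = (padicIntCast ℂ_[2] ((A₀ : ℤ_[2]ˣ) : ℤ_[2])) ^ (k' + 1) *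
          ((ι.symm (-12 * (((Ideal.absNorm i.1 : ℕ) : ℂ) * LM.eisensteinE (k' + 1) (w₀.embedding ((α₀ : 𝓞 K) : K) * (w₀.embedding ((ψK 𝔟 : 𝓞 K) : K) * Ω)) - (Lat i.1).eisensteinE (k' + 1) (w₀.embedding ((α₀ : 𝓞 K) : K) * (w₀.embedding ((ψK 𝔟 : 𝓞 K) : K) * Ω)))) : PadicAlgCl 2) : ℂ_[2]))
    :
    ∀ (K : Type) [Field K] [NumberField K] [IsTotallyComplex K] (hK : IsImaginaryQuadratic K) (_ : NumberField.classNumber K = 1)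
      (ι : PadicAlgCl 2 ≃+* ℂ) (w₀ : InfinitePlace K) (v vbar : HeightOneSpectrum (𝓞 K))
        (hv2 : ((2 : ℕ) : 𝓞 K) ∈ v.asIdeal) (hvbar2 : ((2 : ℕ) : 𝓞 K) ∈ vbar.asIdeal) (hne : vbar ≠ v)
        (_ : ∀ (w : InfinitePlace K) (k : 𝓞 K), k ∈ v.asIdeal ↔ ‖ι.symm (w.embedding (k : K))‖ < 1) {α₀ : 𝓞 K} (hv0 : v.asIdeal = Ideal.span {α₀})
        (hdK : NumberField.discr K = -7) (hα₀ : α₀ ^ 2 - α₀ + 2 = 0) (hw2 : ∀ uu : (𝓞 K)ˣ, (uu : 𝓞 K) - 1 ∈ vbar.asIdeal ^ 2 → uu = 1)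
    (hq : residueFieldCard (v.adicCompletion K) = 2) (h2 : (valuation (v.adicCompletion K)).IsUniformizer ((((2 : ℕ) : 𝒪[v.adicCompletion K]) : v.adicCompletion K)))
    (u : 𝒪[v.adicCompletion K]ˣ)
    (hu : ((((u : 𝒪[v.adicCompletion K]) * ((2 : ℕ) : 𝒪[v.adicCompletion K]) : 𝒪[v.adicCompletion K]) : v.adicCompletion K)) = ((α₀ : K) : v.adicCompletion K))
    {σ₀ : absoluteGaloisGroup (v.adicCompletion K)} (hσ₀ : IsAbsArithFrob σ₀) {ε : (maxUnramifiedCompletion (v.adicCompletion K))ˣ}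
    (hε : maxUnramifiedCompletion.galAut (v.adicCompletion K) σ₀ (ε : maxUnramifiedCompletion (v.adicCompletion K)) =
      algebraMap 𝒪[v.adicCompletion K] (maxUnramifiedCompletion (v.adicCompletion K)) (u : 𝒪[v.adicCompletion K]) * (ε : maxUnramifiedCompletion (v.adicCompletion K)))
    (θ : CompletedAlgClosure (v.adicCompletion K) →+* ℂ_[2]) (hθ1 : ∀ z : CBall (v.adicCompletion K), ‖θ (z : CompletedAlgClosure (v.adicCompletion K))‖ ≤ 1)
    (e₂ : v.adicCompletionIntegers K ≃+* ℤ_[2]) (hΘe : ∀ a : 𝒪[v.adicCompletion K], (θ.comp ((CBall (v.adicCompletion K)).subtype.comp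
        (algebraMap (UnrCoeff (v.adicCompletion K)) (CBall (v.adicCompletion K))))) (intToUnrCoeff (v.adicCompletion K) a) =
      padicIntCast ℂ_[2] (((e₂ : v.adicCompletionIntegers K →+* ℤ_[2]).comp (integerEquivAdicCompletionIntegers v).toRingHom) a)) (_ : Continuous θ)
        (_ : ∀ ζ' : ℂ_[2], (∃ n : ℕ, ζ' ^ 2 ^ n = 1) → ∃ ζ : CompletedAlgClosure (v.adicCompletion K), (∃ n : ℕ, ζ ^ 2 ^ n = 1) ∧ θ ζ = ζ')
        (_ : Function.Bijective θ) (_ : ∀ z : CompletedAlgClosure (v.adicCompletion K), ‖z‖ < 1 → ‖θ z‖ < 1),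
      ∃ (Ω : ℂ) (Ωp : (unrIntegers 2)ˣ) (Θε : ℂ_[2]) (τ : absoluteGaloisGroup K), Ω ≠ 0 ∧ ‖Θε‖ ≤ 1 ∧ ∀ (S : Finset (HeightOneSpectrum (𝓞 K))), v ∉ S → vbar ∉ S →
      ∀ (𝔣 : ℕ → Ideal (𝓞 K)) (𝔩 : ℕ → HeightOneSpectrum (𝓞 K)) (𝔪c : ℕ → Ideal (𝓞 K)) (b : ℕ → ℕ) (_ : 𝔣 0 = (∏ w ∈ S, w.asIdeal) * vbar.asIdeal ^ 2)
        (h𝔣succ : ∀ k, 𝔣 (k + 1) = 𝔣 k * (𝔩 k).asIdeal) (hdiv : ∀ k, (𝔩 k).asIdeal ∣ 𝔣 k) (_ : ∀ k, 𝔣 k = 𝔪c k * vbar.asIdeal ^ (b k + 1)) (_ : ∀ k, 1 ≤ b k)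
        (_ : ∀ k, ¬ 𝔪c k ≤ v.asIdeal) (_ : ∀ k, ¬ 𝔪c k ≤ vbar.asIdeal) (_ : ∀ k, 𝔩 k = vbar ∨ 𝔩 k ∈ S) (_ : ∀ m : ℕ, ∃ n, 𝔣 n ≤ ((∏ w ∈ S, w.asIdeal) * vbar.asIdeal) ^ m)
    (h𝔣0 : ∀ m : ℕ, 𝔣 m ≠ ⊥) (h𝔣1 : ∀ m : ℕ, 𝔣 m ≠ ⊤) (hvm : ∀ m : ℕ, ¬ 𝔣 m ≤ v.asIdeal) (hwm : ∀ (m : ℕ) (u : (𝓞 K)ˣ), (u : 𝓞 K) - 1 ∈ 𝔣 m → u = 1)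
      (hle : ∀ m : ℕ, 𝔣 (m + 1) ≤ 𝔣 m) (α : ℕ → 𝓞 K) (hα0 : ∀ m, α m ≠ 0) (hα𝔣 : ∀ m, α m - 1 ∈ 𝔣 m) (hαw : ∀ (m : ℕ) (w : HeightOneSpectrum (𝓞 K)), w ≠ v → α m ∉ w.asIdeal)
      (f : ℕ → ℕ) (hαπ : ∀ m, ((α m : K) : v.adicCompletion K) =
        ((((u : 𝒪[v.adicCompletion K]) * ((2 : ℕ) : 𝒪[v.adicCompletion K]) : 𝒪[v.adicCompletion K]) : v.adicCompletion K)) ^ f m)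
      (E : ℕ → IntermediateField (v.adicCompletion K) (AlgebraicClosure (v.adicCompletion K)))
      (_ : ∀ m, FiniteDimensional (v.adicCompletion K) (E m)) (_ : ∀ m, IsGalois (v.adicCompletion K) (E m)) (hE : ∀ m, E m ≤ maxUnramified (v.adicCompletion K))
      (hdegE : ∀ (m : ℕ) (w : WeilGroup (v.adicCompletion K)), WeilGroup.toAbsGalois (v.adicCompletion K) w ∈ (E m).fixingSubgroup → (f m : ℤ) ∣ WeilGroup.deg w)
      (hEE : ∀ m, E m ≤ E (m + 1)) (j : ∀ m : ℕ, unitBall (E m) →+* UnrCoeff (v.adicCompletion K))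
      (_ : ∀ m, (j m).comp (algebraMap (LTCoeff (v.adicCompletion K)) (unitBall (E m))) =
        (intToUnrCoeff (v.adicCompletion K)).comp (LTCoeff.of (v.adicCompletion K)).symm.toRingHom)
      (hjC : ∀ m, (algebraMap (UnrCoeff (v.adicCompletion K)) (CBall (v.adicCompletion K))).comp (j m) = unitBallToCBall (E m))
      (_ : ∀ (m : ℕ) (y : unitBall (E m)), j (m + 1) (inclUnitBall (F := v.adicCompletion K) (hEE m) y) = j m y)
      (ψ : ∀ m n : ℕ, ↥(absRestrictNormalHom (rayClassField K (𝔣 m))).ker ⧸ (rayAdicTower (𝔪 := 𝔣 m) (h𝔣0 m) v).U n → ZMod (2 ^ (n + 1)))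
      (hψ : ∀ (m n : ℕ) (g : ↥(absRestrictNormalHom (rayClassField K (𝔣 m))).ker), g ∈ (rayAdicTower (𝔪 := 𝔣 m) (h𝔣0 m) v).U 0 →
        ψ m n ((rayAdicTower (𝔪 := 𝔣 m) (h𝔣0 m) v).proj n g) = PadicInt.toZModPow (n + 1) ((((Units.map (e₂ : v.adicCompletionIntegers K →+* ℤ_[2]).toMonoidHom).comp
            (rayAdicCharacter (h𝔣0 m) (hvm m) (hwm m)))⁻¹ g : ℤ_[2]ˣ) : ℤ_[2])) (g : {c : Ideal (𝓞 K) // c ≠ ⊥ ∧ IsCoprime c (𝔣 0 * v.asIdeal)} → absoluteGaloisGroup K)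
      (_ : ∀ (c : {c : Ideal (𝓞 K) // c ≠ ⊥ ∧ IsCoprime c (𝔣 0 * v.asIdeal)}) (m k : ℕ), absRestrictNormalHom (rayClassField K (𝔣 m * v.asIdeal ^ (k + 1))) (g c) =
          artinSymbol (galFrob K (rayClassField K (𝔣 m * v.asIdeal ^ (k + 1)))) c.1) (x : ∀ (_ : {c : Ideal (𝓞 K) // c ≠ ⊥ ∧ IsCoprime c (𝔣 0 * v.asIdeal)}) (m k : ℕ),
        rayClassField K (𝔣 m * v.asIdeal ^ (k + 1))) (hx : ∀ (c : {c : Ideal (𝓞 K) // c ≠ ⊥ ∧ IsCoprime c (𝔣 0 * v.asIdeal)}) (m k : ℕ),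
        IsThetaValueOne w₀.embedding (𝔣 m * v.asIdeal ^ (k + 1)) c.1 (algClosureEmb w₀.embedding ((x c m k : rayClassField K (𝔣 m * v.asIdeal ^ (k + 1))) : AlgebraicClosure K)))
      (_ : ∀ m n, ((rayAdicTower (𝔪 := 𝔣 m) (h𝔣0 m) v).U n).Normal) (_ : ∀ m n, ((absRayAdicTower (𝔪' := 𝔣 m) (h𝔣0 m) v).U n).Normal)
      (μ : GroupDistribution (SubgroupTower.diagonal (fun m ↦ absRayAdicTower (𝔪' := 𝔣 m) (h𝔣0 m) v) (fun m n ↦ absRayAdicTower_U_anti (h𝔣0 m) (h𝔣0 (m + 1)) v (hle m) n)) ℂ_[2]),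
      μ.bound = 1 → (∀ (c : {c : Ideal (𝓞 K) // c ≠ ⊥ ∧ IsCoprime c (𝔣 0 * v.asIdeal)}) (n : ℕ) (b : absoluteGaloisGroup K ⧸ (absRayAdicTower (𝔪' := 𝔣 n) (h𝔣0 n) v).U n),
        (twisting (g c) (Ideal.absNorm c.1 : ℂ_[2]) μ).μ n b = (GroupDistribution.induceFrom (Γ := absoluteGaloisGroup K)
          (fun k ↦ rayAdicTower_U_eq_subgroupOf (𝔪 := 𝔣 n) (h𝔣0 n) v k) (fun b : GlobalNormCoherentUnits (h𝔣0 n) v ↦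
            localMeasureFamily (h𝔣0 n) (hvm n) (hwm n) hq h2 u (E n) (hE n) hσ₀ hε θ hθ1 (j n) (hjC n) e₂ (ψ n) (hψ n)
              (RelNormCoherentUnits.ofGlobalUnits (h𝔣0 n) (hvm n) (hwm n) (isUniformizer_unit_mul h2 u) (hα0 n) (hα𝔣 n) (hαw n) (hαπ n) (E n) (hE n) (hdegE n) b))
          zero_le_one (fun _ ↦ le_rfl) (ellipticUnitsGlobal h24iii h25 hK w₀.embedding (h𝔣0 n) (h𝔣1 n) (hvm n) (hwm n) c.2.1 (isCoprime_chain 𝔣 𝔩 h𝔣succ hdiv c.2.2 n)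
            (x c n) (hx c n))).μ n b) → ∃ M₁ : ℕ, ∀ (k : ℕ) (w₁ : InfinitePlace K) (lam : HeckeCharacter K) (M : ℕ), M₁ ≤ M → 𝔣 k = modulusIdeal (insert vbar S) (fun _ ↦ M) →
          lam.HasInfinityType (fun _ ↦ 1) (fun _ ↦ 0) → lam.IsModulus (insert vbar S) (fun _ ↦ M) → modulusIdeal (insert vbar S) (fun _ ↦ M) ≠ ⊤ →
          (∀ uu : (𝓞 K)ˣ, (uu : 𝓞 K) - 1 ∈ modulusIdeal (insert vbar S) (fun _ ↦ M) → uu = 1) →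
          ∀ (χ : HeightOneSpectrum (𝓞 K) → ℂ), IsRayClassCharacter (modulusIdeal (insert vbar S) (fun _ ↦ M)) χ →
          ∀ (𝔠 : Ideal (𝓞 K)), 𝔠 ≠ ⊥ → IsCoprime 𝔠 (modulusIdeal (insert vbar S) (fun _ ↦ M)) → IsCoprime 𝔠 v.asIdeal →
          ∀ (εH : HeckeCharacter K) (eH : FramedGaloisRep K (PadicAlgCl 2) 1) (m : ℕ), IsPAdicAvatarOutside S ι εH eH → 3 ≤ m →
            εH.HasInfinityType (fun _ ↦ -(m : ℤ)) (fun _ ↦ 0) → (∀ w : HeightOneSpectrum (𝓞 K), w ∉ S → w ≠ vbar → εH.IsUnramifiedAt w) →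
            (SubgroupTower.diagonal (fun m ↦ absRayAdicTower (𝔪' := 𝔣 m) (h𝔣0 m) v)
                (fun m n ↦ absRayAdicTower_U_anti (h𝔣0 m) (h𝔣0 (m + 1)) v (hle m) n)).IsTowerContinuous (fun σ ↦ avatarValueAt eH σ) →
            (∀ w : HeightOneSpectrum (𝓞 K), ¬ modulusIdeal (insert vbar S) (fun _ ↦ M) ≤ w.asIdeal → εH.valueAtUniformizer w = (χ w)⁻¹ * (lam.valueAtUniformizer w ^ m)⁻¹) →
            ∀ hL : LFunction.HasEntireContinuation (heckeLFunction εH), ∀ I' : ℂ_[2], (12 : ℂ_[2]) * I' = Θε * (twisting τ 0 μ).integral (fun σ ↦ avatarValueAt eH σ) →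
            ∃ (T : Finset (Ideal (𝓞 K))) (L : Ideal (𝓞 K) → PeriodPair), IsRayClassReps (modulusIdeal (insert vbar S) (fun _ ↦ M)) T ∧ (∀ 𝔟 ∈ T, ∀ z : ℂ, z ∈ (L 𝔟).lattice ↔
                ∃ x ∈ ((modulusIdeal (insert vbar S) (fun _ ↦ M) : FractionalIdeal (𝓞 K)⁰ K) / (𝔟 : FractionalIdeal (𝓞 K)⁰ K)), z = Ω * w₁.embedding x) ∧
              (∀ 𝔟 ∈ T, ∀ z : ℂ, z ∈ (L (𝔠 * 𝔟)).lattice ↔ ∃ x ∈ ((modulusIdeal (insert vbar S) (fun _ ↦ M) : FractionalIdeal (𝓞 K)⁰ K) /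
                  ((𝔠 * 𝔟 : Ideal (𝓞 K)) : FractionalIdeal (𝓞 K)⁰ K)), z = Ω * w₁.embedding x) ∧ ((Ideal.absNorm 𝔠 : ℂ_[2]) -
                  ((ι.symm (idealPow K χ 𝔠 * idealPow K (fun w ↦ lam.valueAtUniformizer w) 𝔠 ^ m) : PadicAlgCl 2) : ℂ_[2])) * I' =
                ((ι.symm ((1 - (εH.valueAtUniformizer v)⁻¹ * (((2 : ℕ) : ℂ))⁻¹) * ∑ 𝔟 ∈ T, (idealPow K χ 𝔟)⁻¹ * (idealPow K (fun w ↦ lam.valueAtUniformizer w) 𝔟 ^ m)⁻¹ *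
                      ((Ideal.absNorm 𝔠 : ℂ) * (L 𝔟).eisensteinE m Ω - (L (𝔠 * 𝔟)).eisensteinE m Ω)) : PadicAlgCl 2) : ℂ_[2]) * ((Ωp : unrIntegers 2) : ℂ_[2]) ^ m := by
  classical
  intro K _ _ _ hK hh ι w₀ v vbar hv2 hvbar2 hne hι α₀ hv0 hdK hα₀ hw2 hq h2 u hu σ₀ hσ₀ ε hε θ hθ1 e₂ hΘe hθc hθζ hθb hθlt
  -- the lane inputs at this frame
  obtain ⟨Ω, τ, A₀, 𝔣ψ, ψK, hΩ, h𝔣ψ, hψmul, hψspan, hψone, -, HI2⟩ :=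
    hI2 K hK hh ι w₀ v vbar hv2 hvbar2 hne hι hv0 hdK hα₀ hw2 hq h2 u hu hσ₀ hε θ hθ1 e₂ hΘe hθc hθζ hθb hθlt
  obtain ⟨U, HU⟩ := exists_unit_forall_rayAdicCharacter_mul_integerUnit_grossen_eq (v := v) hne hw2 τ h𝔣ψ ψK hψmul hψspan hψone
  -- the lane's `Θ` and the period `Ωp := Θ(coeff₁ ϑ) · θ(e₂⁻¹(A₀) · U⁻¹)`
  set Θ : UnrCoeff (v.adicCompletion K) →+* ℂ_[2] := θ.comp ((CBall (v.adicCompletion K)).subtype.comp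
    (algebraMap (UnrCoeff (v.adicCompletion K)) (CBall (v.adicCompletion K)))) with hΘdef
  set aU : 𝒪[v.adicCompletion K]ˣ :=
    Units.map ((integerEquivAdicCompletionIntegers v).symm : v.adicCompletionIntegers K →+* 𝒪[v.adicCompletion K]).toMonoidHom
      (Units.map (e₂.symm : ℤ_[2] →+* v.adicCompletionIntegers K).toMonoidHom A₀ * U⁻¹) with haU
  obtain ⟨Ωp, hΩp⟩ :=
    exists_units_unrIntegers_coe_eq_thetaC_coeff_one_compSeriesC_mul_of_isUniformizer h2 θ hθ1 hσ₀ u hε aU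
  have hθaU : θ (algebraMap (v.adicCompletion K) (CompletedAlgClosure (v.adicCompletion K))
      ((aU : 𝒪[v.adicCompletion K]) : v.adicCompletion K)) =
      padicIntCast ℂ_[2] (A₀ : ℤ_[2]) * padicIntCast ℂ_[2] (e₂ ((U⁻¹ : (v.adicCompletionIntegers K)ˣ) : v.adicCompletionIntegers K)) := by
    rw [← thetaC_intToUnrCoeff, hΘe, ← map_mul]
    congr 1
    simp only [haU, RingHom.coe_comp, Function.comp_apply, Units.coe_map, RingHom.toMonoidHom_eq_coe, MonoidHom.coe_coe,
      RingEquiv.toRingHom_eq_coe, RingEquiv.coe_toRingHom, RingEquiv.apply_symm_apply, Units.val_mul, map_mul]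
  have hΩpval : ((Ωp : unrIntegers 2) : ℂ_[2]) = Θ (PowerSeries.coeff 1 (compSeriesC h2 hσ₀ u hε)) *
      (padicIntCast ℂ_[2] (A₀ : ℤ_[2]) * padicIntCast ℂ_[2] (e₂ ((U⁻¹ : (v.adicCompletionIntegers K)ˣ) : v.adicCompletionIntegers K))) := by
    rw [hΩp, hθaU]
  refine ⟨Ω, Ωp, Θ (PowerSeries.coeff 1 (compSeriesC h2 hσ₀ u hε)), τ, hΩ, hθ1 _, ?_⟩
  intro S hvS hvbarS 𝔣 𝔩 𝔪c b h𝔣zero h𝔣succ hdiv h𝔣𝔪c hb h𝔪cv h𝔪cvbar h𝔩S hcof h𝔣0 h𝔣1 hvm hwm hle α hα0 hα𝔣 hαw f hαπ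
    E hfd hgal hE hdegE hEE j hj hjC hjj ψq hψq g hg x hx hN hNabs μ hbd hμ
  obtain ⟨M₁, HM⟩ := HI2 S hvS hvbarS 𝔣 𝔩 𝔪c b h𝔣zero h𝔣succ hdiv h𝔣𝔪c hb h𝔪cv h𝔪cvbar h𝔩S hcof h𝔣0 h𝔣1 hvm hwm hle
    α hα0 hα𝔣 hαw f hαπ E hfd hgal hE hdegE hEE j hj hjC hjj ψq hψq g hg x hx hN hNabs μ hbd hμ
  refine ⟨max M₁ 1, ?_⟩
  intro k w₁ lam M hM hkM hl hlmod h𝔪1 hw χ hχ 𝔠 h𝔠0 h𝔠cop h𝔠v εH eH m he hm hεt hεunr hcont hεu hL I' hI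
  obtain ⟨𝔟, LM, Lat, h𝔟cop, hArt, hLM, hLat, hvals⟩ := HM k M (le_of_max_le_left hM) hkM
  have hM1 : 1 ≤ M := le_of_max_le_right hM
  -- one infinite place
  haveI := subsingleton_infinitePlace_of_finrank_eq_two (K := K) hK.1
  obtain rfl : w₀ = w₁ := Subsingleton.elim _ _
  -- degree one at `v`
  haveI : v.asIdeal.LiesOver (ratPlace 2).asIdeal := liesOver_ratPlace_of_natCast_mem K v hv2
  obtain ⟨he1, hf1⟩ := ramificationIdx_eq_one_and_inertiaDeg_eq_one_of_natCast_mem_of_ne K hK.1 hv2 hvbar2 hne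
  have htwo := KatzMeasureJZeroSeam.eq_or_eq_of_natCast_two_mem hK.1 hv2 hvbar2 hne
  -- the modulus `𝔪_M`
  have h𝔪0 : modulusIdeal (insert vbar S) (fun _ ↦ M) ≠ ⊥ := modulusIdeal_ne_bot _ _
  have hvT : v ∉ insert vbar S := by rw [Finset.mem_insert, not_or]; exact ⟨hne.symm, hvS⟩
  have h𝔪v : ¬ modulusIdeal (insert vbar S) (fun _ ↦ M) ≤ v.asIdeal := by rw [modulusIdeal_le_iff]; exact hvT
  have h𝔪2 : modulusIdeal (insert vbar S) (fun _ ↦ M) ≤ vbar.asIdeal ^ 2 :=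
    (Ideal.le_of_dvd (pow_dvd_modulusIdeal (fun _ ↦ M) (Finset.mem_insert_self vbar S))).trans
      (Ideal.pow_le_pow_right (by omega))
  have hle0 : ∀ n : ℕ, 𝔣 n ≤ 𝔣 0 := fun n ↦ by
    induction n with
    | zero => exact le_rfl
    | succ n ih => exact (hle n).trans ih
  -- the ideal `𝔟` and `β₁ := ψ_K(𝔟)`
  have h𝔟𝔣ψ : IsCoprime 𝔟 𝔣ψ := h𝔟cop.of_mul_right_left.of_mul_right_left
  have h𝔟𝔪 : IsCoprime 𝔟 (modulusIdeal (insert vbar S) (fun _ ↦ M)) := h𝔟cop.of_mul_right_left.of_mul_right_right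
  have h𝔟v : IsCoprime 𝔟 v.asIdeal := h𝔟cop.of_mul_right_right
  have hspan : Ideal.span {ψK 𝔟} = 𝔟 := hψspan 𝔟 h𝔟𝔣ψ
  set β₁ : 𝓞 K := ψK 𝔟 with hβ₁def
  have hβ₁ : IsCoprime (Ideal.span {β₁}) (modulusIdeal (insert vbar S) (fun _ ↦ M) * v.asIdeal) := by
    rw [hspan]; exact h𝔟𝔪.mul_right h𝔟v
  have hβ₁0 : β₁ ≠ 0 := by
    intro h0
    rw [h0, Ideal.span_singleton_eq_bot.mpr rfl, Ideal.isCoprime_iff_sup_eq, bot_sup_eq] at hβ₁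
    exact v.isPrime.ne_top (top_le_iff.mp (hβ₁ ▸ Ideal.mul_le_left))
  have hβne : Ideal.span {β₁} ≠ ⊥ := by simpa [Ideal.span_singleton_eq_bot] using hβ₁0
  have hβc0 : IsCoprime (Ideal.span {β₁}) (𝔣 0 * v.asIdeal) := by
    refine IsCoprime.mul_right ?_ (by rw [hspan]; exact h𝔟v)
    have h' : IsCoprime (Ideal.span {β₁}) (𝔣 k) := by rw [hkM, hspan]; exact h𝔟𝔪
    exact h'.of_isCoprime_of_dvd_right (Ideal.dvd_iff_le.mpr (hle0 k))
  set cβ : {c : Ideal (𝓞 K) // c ≠ ⊥ ∧ IsCoprime c (𝔣 0 * v.asIdeal)} := ⟨Ideal.span {β₁}, hβne, hβc0⟩ with hcβ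
  -- D2's lift `g_{(β₁)}` read at the modulus `𝔣 k = 𝔪_M` for the ideal `𝔟`
  have hg₁ : ∀ n : ℕ, absRestrictNormalHom (rayClassField K (𝔣 k * v.asIdeal ^ (n + 1))) (g cβ) =
      artinSymbol (galFrob K (rayClassField K (𝔣 k * v.asIdeal ^ (n + 1)))) 𝔟 := fun n ↦ by
    have hc1 : (cβ : Ideal (𝓞 K)) = 𝔟 := hspan
    have h := hg cβ k n
    rwa [hc1] at h
  -- the reference modulus `𝔐 = 𝔣_ψ · 𝔪_M · v` of the Artin clause
  have h𝔐0 : 𝔣ψ * modulusIdeal (insert vbar S) (fun _ ↦ M) * v.asIdeal ≠ ⊥ :=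
    mul_ne_zero (mul_ne_zero h𝔣ψ h𝔪0) v.ne_bot
  have h𝔐le : 𝔣ψ * modulusIdeal (insert vbar S) (fun _ ↦ M) * v.asIdeal ≤ 𝔣ψ * vbar.asIdeal ^ 2 * v.asIdeal :=
    Ideal.mul_mono_left (Ideal.mul_mono_right h𝔪2)
  have h𝔐𝔪 : 𝔣ψ * modulusIdeal (insert vbar S) (fun _ ↦ M) * v.asIdeal ≤ 𝔣 k := by
    rw [hkM]; exact Ideal.mul_le_right.trans Ideal.mul_le_left
  -- ★ (U♯): `κ_𝔪(τg)·β₁,v = U`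
  obtain ⟨hβv, hτg, hUeq⟩ := HU (𝔣 k) (h𝔣0 k) (hvm k) (hwm k) (by rw [hkM]; exact h𝔪2) _ h𝔐0 h𝔐le h𝔐𝔪 𝔟 h𝔟cop
    (g cβ) hg₁ hArt
  have hκinv : (rayAdicCharacter (h𝔣0 k) (hvm k) (hwm k) ⟨τ * g cβ, hτg⟩)⁻¹ = integerUnit v β₁ hβv * U⁻¹ := by
    rw [← hUeq, mul_inv_rev, mul_inv_cancel_left]
  -- ★ the avatar on `Gal(K̄/K(𝔪_M))` (bookkeeping, A2)
  have hεmod : εH.IsModulus (insert vbar S) (fun _ ↦ M + 1) := isModulus_const_succ_of_valueAtUniformizer_eq hχ hlmod hεu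
  have hleM : ∀ w ∈ insert vbar S, ((fun _ ↦ M + 1 : HeightOneSpectrum (𝓞 K) → ℕ) w : ℤ) ≤
      FractionalIdeal.count K w ((𝔣 k : Ideal (𝓞 K)) : FractionalIdeal (𝓞 K)⁰ K) := fun w hw' ↦ by
    rw [hkM]; exact natCast_const_succ_le_count_modulusIdeal (insert vbar S) M w hw'
  have hker : avatarValueAt eH (τ * g cβ) =
      (padicIntCast ℂ_[2] (e₂ (integerUnit v β₁ hβv : v.adicCompletionIntegers K)) *
        padicIntCast ℂ_[2] (e₂ ((U⁻¹ : (v.adicCompletionIntegers K)ˣ) : v.adicCompletionIntegers K))) ^ m := by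
    have h := KatzMeasureJZeroSeam.avatarValueAt_ker_eq_padicIntCast_inv_pow hK.1 ι w₀ hv2 hvbar2 hne (hι w₀) (h𝔣0 k) (hvm k)
      (hwm k) e₂ he hεt hεmod hleM ⟨τ * g cβ, hτg⟩
    rw [h, map_pow, MonoidHom.inv_apply, MonoidHom.comp_apply, ← map_inv, hκinv, map_mul, Units.val_mul, map_mul]
    simp only [RingHom.toMonoidHom_eq_coe, Units.coe_map, MonoidHom.coe_coe, RingEquiv.coe_toRingHom]
  -- ★ the two readings agree on `K`: `cast(e₂ β₁,v) = ι⁻¹(σ(β₁))`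
  have hcompat : padicIntCast ℂ_[2] (e₂ (integerUnit v β₁ hβv : v.adicCompletionIntegers K)) =
      ((ι.symm (w₀.embedding ((β₁ : 𝓞 K) : K)) : PadicAlgCl 2) : ℂ_[2]) := by
    rw [ringEquiv_eq_padicIntEquivOfDegreeOne he1 hf1 e₂, AvatarOnRay.padicIntCast_padicComplex_eq_coe,
      coe_padicIntEquivOfDegreeOne_apply, coe_integerUnit]
    congr 1
    have h := RingHom.congr_fun (AvatarOnRay.comp_eq_of_place_eq (p := 2) ι he1 hf1 w₀.embedding (hι w₀)) ((β₁ : 𝓞 K) : K)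
    simp only [RingHom.coe_comp, Function.comp_apply, RingHom.coe_coe] at h
    rw [← h, RingEquiv.symm_apply_apply]
    rfl
  -- ★ A9: `ê(g_{(β₁)}) = ι⁻¹(χ̃λ̃^m((β₁)))`
  have hIS : ∀ w : HeightOneSpectrum (𝓞 K), (cβ : Ideal (𝓞 K)) ≤ w.asIdeal → w ∉ S ∧ ((2 : ℕ) : 𝓞 K) ∉ w.asIdeal := by
    intro w hiw
    have hw𝔪 : ¬ modulusIdeal (insert vbar S) (fun _ ↦ M) ≤ w.asIdeal := fun h ↦
      (isCoprime_iff_forall_not_le h𝔪0).mp hβ₁.of_mul_right_left w h hiw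
    have hwv : ¬ v.asIdeal ≤ w.asIdeal := fun h ↦ (isCoprime_iff_forall_not_le v.ne_bot).mp hβ₁.of_mul_right_right w h hiw
    have hwT : w ∉ insert vbar S := by rwa [modulusIdeal_le_iff] at hw𝔪
    rw [Finset.mem_insert, not_or] at hwT
    refine ⟨hwT.2, fun hw2' ↦ ?_⟩
    rcases htwo w hw2' with rfl | rfl
    · exact hwv le_rfl
    · exact hwT.1 rfl
  have hIF : ∀ p : ℕ × ℕ, IsCoprime (cβ : Ideal (𝓞 K)) (𝔣 p.1 * v.asIdeal ^ (p.2 + 1)) := fun p ↦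
    isCoprime_mul_pow_succ (isCoprime_chain 𝔣 𝔩 h𝔣succ hdiv cβ.2.2 p.1) p.2
  have hunr' : ∀ w : HeightOneSpectrum (𝓞 K), w ∉ S → ((2 : ℕ) : 𝓞 K) ∉ w.asIdeal → εH.IsUnramifiedAt w :=
    fun w hwS hw2' ↦ hεunr w hwS (fun h ↦ hw2' (h ▸ hvbar2))
  have hF0 : ∀ p : ℕ × ℕ, 𝔣 p.1 * v.asIdeal ^ (p.2 + 1) ≠ ⊥ := fun p ↦ mul_ne_zero (h𝔣0 p.1) (pow_ne_zero _ v.ne_bot)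
  have hray : ∀ σ : absoluteGaloisGroup K, (∀ p : ℕ × ℕ, absRestrictNormalHom (rayClassField K (𝔣 p.1 * v.asIdeal ^ (p.2 + 1))) σ = 1) →
      σ ∈ DeShalit1987.rayKer K 2 S := by
    intro σ hσ
    have hsub := DeShalit1987.iInter_diagonal_absRayAdicTower_subset_rayKer_of_finrank_eq_two 2 S h𝔣0
      (fun m n ↦ absRayAdicTower_U_anti (h𝔣0 m) (h𝔣0 (m + 1)) v (hle m) n) hK.1 hv2 hvbar2 hne hle hcof
    refine hsub (Set.mem_iInter.mpr fun n ↦ ?_)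
    rw [SetLike.mem_coe, SubgroupTower.diagonal_U, mem_absRayAdicTower_U_iff, MonoidHom.mem_ker]
    exact hσ (n, n)
  have hA9 : avatarValueAt eH (g cβ) =
      ((ι.symm (idealPow K χ (Ideal.span {β₁}) * idealPow K (fun w ↦ lam.valueAtUniformizer w) (Ideal.span {β₁}) ^ m) :
        PadicAlgCl 2) : ℂ_[2]) :=
    he.avatarValueAt_eq_idealPow_mul_pow_of_forall_absRestrictNormalHom_eq_artinSymbol hunr'
      (F := fun p : ℕ × ℕ ↦ 𝔣 p.1 * v.asIdeal ^ (p.2 + 1)) hF0 hray cβ.2.1 hIS hIF (fun p ↦ hg cβ p.1 p.2) h𝔪0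
      hβ₁.of_mul_right_left hεu
  -- ★ `ê(τ)·ι⁻¹(χ̃λ̃^m((β₁))) = (ι⁻¹(σ(β₁))·cast(e₂ U⁻¹))^m`
  set τC : ℂ →+* ℂ_[2] := (algebraMap (PadicAlgCl 2) ℂ_[2]).comp ι.symm.toRingHom with hτC
  have hτapp : ∀ z : ℂ, ((ι.symm z : PadicAlgCl 2) : ℂ_[2]) = τC z := fun z ↦ rfl
  set X : ℂ_[2] := τC (w₀.embedding ((β₁ : 𝓞 K) : K)) with hXdef
  set P : ℂ_[2] := padicIntCast ℂ_[2] (e₂ ((U⁻¹ : (v.adicCompletionIntegers K)ˣ) : v.adicCompletionIntegers K)) with hPdef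
  have hX : X ≠ 0 := by
    rw [hXdef, map_ne_zero_iff _ (RingHom.injective _), map_ne_zero_iff _ w₀.embedding.injective]
    exact_mod_cast hβ₁0
  have hkey : avatarValueAt eH τ * τC (idealPow K χ (Ideal.span {β₁}) * idealPow K (fun w ↦ lam.valueAtUniformizer w) (Ideal.span {β₁}) ^ m) =
      (X * P) ^ m := by
    rw [← hτapp, ← hA9, ← avatarValueAt_mul, hker, hcompat, hτapp]
  -- ★ [I1]'s scalar hypotheses
  have hD : (twisting τ 0 μ).integral (fun σ ↦ avatarValueAt eH σ) =
      avatarValueAt eH τ * μ.integral (fun σ ↦ avatarValueAt eH σ) :=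
    integral_twisting_zero_of_map_mul' τ μ hcont (fun x ↦ avatarValueAt_mul eH τ x)
  have hI' : (12 : ℂ_[2]) * I' = avatarValueAt eH τ * (Θ (PowerSeries.coeff 1 (compSeriesC h2 hσ₀ u hε)) *
      μ.integral (fun σ ↦ avatarValueAt eH σ)) := by
    rw [hI, hD]; ring
  have hΩp' : ((Ωp : unrIntegers 2) : ℂ_[2]) ^ m = avatarValueAt eH τ *
      ((Θ (PowerSeries.coeff 1 (compSeriesC h2 hσ₀ u hε)) * padicIntCast ℂ_[2] ((A₀ : ℤ_[2]ˣ) : ℤ_[2])) ^ m *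
        ((ι.symm (((w₀.embedding ((β₁ : 𝓞 K) : K)) ^ m)⁻¹ *
          (idealPow K χ (Ideal.span {β₁}) * idealPow K (fun w ↦ lam.valueAtUniformizer w) (Ideal.span {β₁}) ^ m)) :
            PadicAlgCl 2) : ℂ_[2])) := by
    rw [hτapp, map_mul τC, map_inv₀, map_pow, ← hXdef, hΩpval]
    calc (Θ (PowerSeries.coeff 1 (compSeriesC h2 hσ₀ u hε)) * (padicIntCast ℂ_[2] ((A₀ : ℤ_[2]ˣ) : ℤ_[2]) * P)) ^ m
        = (Θ (PowerSeries.coeff 1 (compSeriesC h2 hσ₀ u hε)) * padicIntCast ℂ_[2] ((A₀ : ℤ_[2]ˣ) : ℤ_[2])) ^ m *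
            ((X ^ m)⁻¹ * (X * P) ^ m) := by
          rw [mul_pow X P, ← mul_assoc (X ^ m)⁻¹, inv_mul_cancel₀ (pow_ne_zero m hX), one_mul]; ring
      _ = (Θ (PowerSeries.coeff 1 (compSeriesC h2 hσ₀ u hε)) * padicIntCast ℂ_[2] ((A₀ : ℤ_[2]ˣ) : ℤ_[2])) ^ m *
            ((X ^ m)⁻¹ * (avatarValueAt eH τ * τC (idealPow K χ (Ideal.span {β₁}) *
              idealPow K (fun w ↦ lam.valueAtUniformizer w) (Ideal.span {β₁}) ^ m))) := by rw [hkey]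
      _ = _ := by ring
  -- ★ [I1] at this instance
  exact KatzMeasureJZeroSeam.hsumBody_at_level_of_perUnitValues h24ii h24iii h25 hK ι w₀ hv2 hvbar2 hne hι hv0 hq h2 u hu
    hσ₀ hε θ hθc hθ1 hθζ e₂ hΘe hvS hvbarS 𝔣 𝔩 h𝔣succ hdiv hcof h𝔣0 h𝔣1 hvm hwm hle α hα0 hα𝔣 hαw f hαπ E hE hdegE hEE j hj hjC
    hjj ψq hψq g hg x hx μ hμ k M hkM lam hl hlmod h𝔪1 hw χ hχ 𝔠 h𝔠0 h𝔠cop h𝔠v εH eH m he hm hεt hεunr hεu hL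
    (padicIntCast ℂ_[2] ((A₀ : ℤ_[2]ˣ) : ℤ_[2])) Ω hΩ hβ₁ _ rfl _ rfl LM hLM Lat hLat hvals I' Ωp (avatarValueAt eH τ) hI' hΩp'

end Summit.BirchSwinnertonDyer.BirchSwinnertonDyer.Theorems.PrintCf2.KatzMeasureJZeroTop

end
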